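import Mathlib
import Literature.Probability.Distributions.ExponentialLogMoment

/-!
# Toward stub P3 `stub_liaSymbol` (line `child_tangent_analytic_strip`, child 28295 of `SkeletonJ1G`) —
# THE EULER–MASCHERONI BRIDGE: `∫₀^∞ log t·e^{−t} dt = −γ` and `γ = ∫₀^1 (1−e^{−t})/t dt − ∫₁^∞ e^{−t}/t dt`

Lane ns-filament-19175-p1 g12 (prover), 2026-08-28, `--supports stmt-NavierStokesRegularity-28295 --as helper`.

Part (c) of `LiaSymbolBound` is the Klein–Majda small-`x` asymptotics of the exact self-induction symbol, whose constant
involves `Real.eulerMascheroniConstant`.  Mathlib knows `γ` as the limit of `H_n − log n` and proves `Γ′(1) = −γ`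
(`Real.hasDerivAt_Gamma_one`) and the Mellin-type formula for the derivative of the `Γ`-integral
(`Complex.hasDerivAt_GammaIntegral`).  The tree already has `∫₀^∞ log t·e^{−t} dt = −γ`
(`Literature.Probability.Distributions.integral_log_mul_exp_neg_Ioi`, reused); this file adds, by two
fundamental-theorem-of-calculus computations (`(1−e^{−t})·log t` on `[0,1]`, `−e^{−t}·log t` on `[1,∞)`), the form the
asymptotics needs: `γ = Ein(1) − E₁(1) = ∫₀^1 (1−e^{−t})/t dt − ∫₁^∞ e^{−t}/t dt` (§2).  Def-free (explicit integrals only).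

HONEST FRAMING: classical real analysis serving a HYPOTHETICAL filament-skeleton line on the NEGATIVE side of a MODEL
route; nothing here bears on Navier–Stokes regularity or blow-up.
-/

set_option linter.dupNamespace false

noncomputable section

namespace Summit.NavierStokesRegularity.NavierStokesRegularity.Theorems.AnalyticStripLiaSymbol

open Real Set MeasureTheory Filter Topology

/-! ## §1  `∫₀^∞ log t · e^{−t} dt = −γ` — already in the tree

`Literature.Probability.Distributions.integral_log_mul_exp_neg_Ioi` (from `Γ′(1) = −γ`) and
`Literature.Probability.Distributions.integrableOn_log_mul_exp_neg_Ioi`; reused, not restated. -/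

/-! ## §2  `γ = Ein(1) − E₁(1)` -/

/-- On `[1, ∞)`: `∫₁^∞ e^{−t} log t dt = ∫₁^∞ e^{−t}/t dt` (`d/dt[−e^{−t} log t] = e^{−t} log t − e^{−t}/t`). -/
theorem integral_Ioi_one_exp_neg_mul_log :
    ∫ t in Ioi (1:ℝ), Real.log t * Real.exp (-t) = ∫ t in Ioi (1:ℝ), Real.exp (-t) / t := by
  -- integrability of both pieces on `(1, ∞)`
  have hlog : IntegrableOn (fun t : ℝ => Real.log t * Real.exp (-t)) (Ioi 1) := by
    -- `log t ≤ t` on `(1,∞)`, and `t e^{-t}` is integrable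
    have hdom : IntegrableOn (fun t : ℝ => t * Real.exp (-t)) (Ioi 1) := by
      have := (Real.GammaIntegral_convergent (s := 2) (by norm_num)).mono_set
        (Ioi_subset_Ioi (zero_le_one : (0:ℝ) ≤ 1))
      refine this.congr_fun (fun t ht => ?_) measurableSet_Ioi
      simp only [show (2:ℝ) - 1 = 1 by norm_num, Real.rpow_one, mul_comm]
    refine hdom.mono' ?_ ?_
    · exact ((Real.measurable_log.mul (Real.measurable_exp.comp measurable_neg))).aestronglyMeasurable
    · rw [ae_restrict_iff' measurableSet_Ioi]
      refine Filter.Eventually.of_forall fun t (ht : 1 < t) => ?_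
      rw [Real.norm_eq_abs, abs_mul, abs_of_pos (Real.exp_pos _),
        abs_of_nonneg (Real.log_nonneg ht.le)]
      gcongr
      exact (Real.log_le_sub_one_of_pos (by linarith)).trans (by linarith)
  have hinv : IntegrableOn (fun t : ℝ => Real.exp (-t) / t) (Ioi 1) := by
    have hdom : IntegrableOn (fun t : ℝ => Real.exp (-t)) (Ioi 1) := integrableOn_exp_neg_Ioi 1
    refine hdom.mono' ?_ ?_
    · exact ((Real.measurable_exp.comp measurable_neg).div measurable_id).aestronglyMeasurable
    · rw [ae_restrict_iff' measurableSet_Ioi]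
      refine Filter.Eventually.of_forall fun t (ht : 1 < t) => ?_
      rw [Real.norm_eq_abs, abs_div, abs_of_pos (Real.exp_pos _), abs_of_pos (by linarith)]
      exact div_le_self (Real.exp_pos _).le ht.le
  -- FTC on `(1, ∞)` for `f t = −e^{−t} log t`
  have hderiv : ∀ t ∈ Ioi (1:ℝ), HasDerivAt (fun u : ℝ => -Real.exp (-u) * Real.log u)
      (Real.log t * Real.exp (-t) - Real.exp (-t) / t) t := by
    intro t ht
    have ht0 : t ≠ 0 := by linarith [mem_Ioi.mp ht]
    have h0 : HasDerivAt (fun u : ℝ => Real.exp (-u)) (Real.exp (-t) * (-1)) t :=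
      (Real.hasDerivAt_exp (-t)).comp t (hasDerivAt_neg t)
    have h1 : HasDerivAt (fun u : ℝ => -Real.exp (-u)) (Real.exp (-t)) t := by
      have := h0.neg
      exact this.congr_deriv (by ring)
    have h2 : HasDerivAt (fun u : ℝ => Real.log u) (t⁻¹) t := Real.hasDerivAt_log ht0
    have := h1.mul h2
    refine (this : HasDerivAt (fun u : ℝ => -Real.exp (-u) * Real.log u) _ t).congr_deriv ?_
    rw [div_eq_mul_inv]; ring
  have hlim : Tendsto (fun u : ℝ => -Real.exp (-u) * Real.log u) atTop (𝓝 0) := by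
    -- `|e^{-u} log u| ≤ u e^{-u} → 0`
    have h0 : Tendsto (fun u : ℝ => u * Real.exp (-u)) atTop (𝓝 0) := by
      have := Real.tendsto_pow_mul_exp_neg_atTop_nhds_zero 1
      simpa using this
    refine squeeze_zero_norm' ?_ h0
    filter_upwards [eventually_ge_atTop (1:ℝ)] with u hu
    rw [norm_mul, norm_neg, Real.norm_eq_abs, Real.norm_eq_abs, abs_of_pos (Real.exp_pos _),
      abs_of_nonneg (Real.log_nonneg hu), mul_comm]
    gcongr
    exact (Real.log_le_sub_one_of_pos (by linarith)).trans (by linarith)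
  have hcont : ContinuousWithinAt (fun u : ℝ => -Real.exp (-u) * Real.log u) (Ici 1) 1 := by
    refine ContinuousAt.continuousWithinAt ?_
    exact ((Real.continuous_exp.comp continuous_neg).neg.continuousAt).mul
      (Real.continuousAt_log (by norm_num))
  have hftc := integral_Ioi_of_hasDerivAt_of_tendsto hcont hderiv (hlog.sub hinv) hlim
  simp only [Real.log_one, mul_zero, sub_zero] at hftc
  rw [integral_sub hlog hinv] at hftc
  linarith


/-- On `[0, 1]`: `∫₀^1 e^{−t} log t dt = −∫₀^1 (1−e^{−t})/t dt` (`d/dt[(1−e^{−t}) log t] = e^{−t} log t + (1−e^{−t})/t`,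
and `(1−e^{−t}) log t → 0` at both ends). -/
theorem integral_Ioc_exp_neg_mul_log :
    ∫ t in Ioc (0:ℝ) 1, Real.log t * Real.exp (-t) = -∫ t in Ioc (0:ℝ) 1, (1 - Real.exp (-t)) / t := by
  -- the primitive and its derivative
  have hderiv : ∀ t ∈ Ioo (0:ℝ) 1, HasDerivAt (fun u : ℝ => (1 - Real.exp (-u)) * Real.log u)
      (Real.log t * Real.exp (-t) + (1 - Real.exp (-t)) / t) t := by
    intro t ht
    have ht0 : t ≠ 0 := ht.1.ne'
    have h0 : HasDerivAt (fun u : ℝ => Real.exp (-u)) (Real.exp (-t) * (-1)) t :=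
      (Real.hasDerivAt_exp (-t)).comp t (hasDerivAt_neg t)
    have h1 : HasDerivAt (fun u : ℝ => 1 - Real.exp (-u)) (Real.exp (-t)) t := by
      have := (hasDerivAt_const t (1:ℝ)).sub h0
      exact this.congr_deriv (by ring)
    have h2 : HasDerivAt (fun u : ℝ => Real.log u) (t⁻¹) t := Real.hasDerivAt_log ht0
    have := h1.mul h2
    refine (this : HasDerivAt (fun u : ℝ => (1 - Real.exp (-u)) * Real.log u) _ t).congr_deriv ?_
    rw [div_eq_mul_inv]; ring
  -- continuity of the primitive on `[0,1]` (at `0`: squeezed by `|t log t|`)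
  have hcont : ContinuousOn (fun u : ℝ => (1 - Real.exp (-u)) * Real.log u) (Icc 0 1) := by
    intro x hx
    rcases eq_or_lt_of_le hx.1 with h | h
    · -- x = 0
      subst h
      rw [ContinuousWithinAt]
      simp only [neg_zero, Real.exp_zero, sub_self, Real.log_zero, mul_zero]
      have hb : Tendsto (fun u : ℝ => u * Real.log u) (𝓝[Icc 0 1] 0) (𝓝 0) := by
        have := (Real.continuous_mul_log.tendsto 0)
        simp only [zero_mul] at this
        exact tendsto_nhdsWithin_of_tendsto_nhds this
      refine squeeze_zero_norm' ?_ (tendsto_norm_zero.comp hb)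
      filter_upwards [self_mem_nhdsWithin] with u hu
      rw [norm_mul, Real.norm_eq_abs, Real.norm_eq_abs, Function.comp_apply, norm_mul,
        Real.norm_eq_abs, Real.norm_eq_abs, abs_of_nonneg (by nlinarith [Real.exp_le_one_iff.mpr (neg_nonpos.mpr hu.1)] : (0:ℝ) ≤ 1 - Real.exp (-u)),
        abs_of_nonneg hu.1]
      gcongr
      linarith [Real.add_one_le_exp (-u)]
    · exact (((continuous_const.sub (Real.continuous_exp.comp continuous_neg)).continuousAt).mul
        (Real.continuousAt_log h.ne')).continuousWithinAt
  -- interval integrability of the derivative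
  have hint1 : IntervalIntegrable (fun t : ℝ => Real.log t * Real.exp (-t)) volume 0 1 :=
    (intervalIntegral.intervalIntegrable_log').mul_continuousOn (Real.continuous_exp.comp continuous_neg).continuousOn
  have hint2 : IntervalIntegrable (fun t : ℝ => (1 - Real.exp (-t)) / t) volume 0 1 := by
    rw [intervalIntegrable_iff_integrableOn_Ioc_of_le zero_le_one]
    refine IntegrableOn.of_bound (by simp) ?_ 1 ?_
    · exact (((continuous_const.sub (Real.continuous_exp.comp continuous_neg)).measurable).div
        measurable_id).aestronglyMeasurable
    · rw [ae_restrict_iff' measurableSet_Ioc]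
      refine Filter.Eventually.of_forall fun t ht => ?_
      rw [Real.norm_eq_abs, abs_div, abs_of_nonneg (by nlinarith [Real.exp_le_one_iff.mpr (neg_nonpos.mpr ht.1.le)]
        : (0:ℝ) ≤ 1 - Real.exp (-t)), abs_of_pos ht.1, div_le_one ht.1]
      linarith [Real.add_one_le_exp (-t)]
  have hftc := intervalIntegral.integral_eq_sub_of_hasDerivAt_of_le zero_le_one hcont hderiv (hint1.add hint2)
  simp only [Real.log_one, mul_zero, neg_zero, Real.exp_zero, sub_self, Real.log_zero] at hftc
  rw [intervalIntegral.integral_add hint1 hint2, intervalIntegral.integral_of_le zero_le_one,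
    intervalIntegral.integral_of_le zero_le_one] at hftc
  linarith

/-- **`γ = Ein(1) − E₁(1)`**: `γ = ∫₀^1 (1−e^{−t})/t dt − ∫₁^∞ e^{−t}/t dt`. -/
theorem eulerMascheroni_eq_Ein_sub_E1 :
    Real.eulerMascheroniConstant
      = (∫ t in Ioc (0:ℝ) 1, (1 - Real.exp (-t)) / t) - ∫ t in Ioi (1:ℝ), Real.exp (-t) / t := by
  have hsplit : ∫ t in Ioi (0:ℝ), Real.log t * Real.exp (-t)
      = (∫ t in Ioc (0:ℝ) 1, Real.log t * Real.exp (-t)) + ∫ t in Ioi (1:ℝ), Real.log t * Real.exp (-t) := by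
    rw [← setIntegral_union (Set.Ioc_disjoint_Ioi le_rfl) measurableSet_Ioi
      (Literature.Probability.Distributions.integrableOn_log_mul_exp_neg_Ioi.mono_set Ioc_subset_Ioi_self)
      (Literature.Probability.Distributions.integrableOn_log_mul_exp_neg_Ioi.mono_set (Ioi_subset_Ioi zero_le_one)),
      Ioc_union_Ioi_eq_Ioi zero_le_one]
  have h := Literature.Probability.Distributions.integral_log_mul_exp_neg_Ioi
  rw [hsplit, integral_Ioc_exp_neg_mul_log, integral_Ioi_one_exp_neg_mul_log] at h
  linarith

end Summit.NavierStokesRegularity.NavierStokesRegularity.Theorems.AnalyticStripLiaSymbol
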